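import Summits.RiemannHypothesis.RiemannHypothesis.Theses.CharacterSums

/-!
# Birth skeleton — crux `CharacterImitation` (stmt-RiemannHypothesis-16982), route `CharacterSums`

Crux (route decl `Summit.RiemannHypothesis.RiemannHypothesis.Theses.CharacterSums.CharacterImitation`,
verbatim): positivity of `f_q(x) = ∑' n, (n/q)·sin(2πnx)/n²` on `[0, 1/4]` for EVERY prime
`q ≡ 3 (mod 8)` implies positivity of the Liouville sine series `f(x) = ∑' n, λ(n)·sin(2πnx)/n²`
on `[0, 1/4]` — the reduction inside Conrey 2024, Theorem 3 (arXiv:2404.19647, p. 4: "if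
`f(x₀) < 0` … find a `q` such that `(n/q) = λ(n)` for all `n ≤ N` where `N` is chosen so large that
`|f(x₀)| > 1/N`; then … `f_q(x₀) < 0`").

Skeleton (two registered stubs, composition `CharacterImitation_of` PROVED below):

* `stub_imitatingPrimes` — ARITHMETIC INPUT (verbatim the route's support item `ImitatingPrimes`,
  stmt-RiemannHypothesis-16984, so one `Theorems/` proof closes both): for every `N` there is a prime
  `q ≡ 3 (mod 8)`, `q > N`, whose Legendre symbol agrees with `λ` on `[1, N]`.  Engine: `q ≡ 3 (mod 8)`
  gives `(2/q) = −1 = λ(2)` (`jacobiSym.at_two`, `ZMod.χ₈`); for each odd prime `p ≤ N` pick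
  `q mod p` so that `(p/q) = −1` via quadratic reciprocity with `q ≡ 3 (mod 4)`
  (`jacobiSym.quadratic_reciprocity`, `legendreSym`/`ZMod.isSquare` counting); CRT + Dirichlet
  (`Nat.setOf_prime_and_eq_mod_infinite`); then complete multiplicativity in `n`
  (`jacobiSym.mul_left`, `ArithmeticFunction.liouville_apply_mul`).  Size M.  In-tree template:
  `MatsunoCurvesPrimesProofs.exists_prime_gt_modEq_one_jacobiSym_eq` (grounder g74-2).
* `stub_sineTail` — ANALYTIC TAIL TRANSFER: two real coefficient sequences bounded by `1` in absolute
  value that agree on `[1, N]` (`N ≥ 1`) have sine series `∑' n, aₙ sin(2πnx)/n²` within `2/N` of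
  each other, uniformly in `x` (the `n = 0` terms vanish: `sin 0 = 0` and `x/0 = 0`; both series are
  summable by comparison with `∑ 1/n²`; tail `∑_{n>N} 2/n² ≤ 2 ∑_{n>N} 1/(n(n−1)) = 2/N`).  Size M.
  Stated for general sequences: it is the same lemma for `(λ, (·/q))` and is reusable.

Composition `CharacterImitation_of (hI : Sig.stub_imitatingPrimes) (hT : Sig.stub_sineTail) :
CharacterImitation` is Conrey's half-page argument run as an archimedean squeeze (no contradiction
needed): for `x ∈ [0, 1/4]` and every `N ≥ 1` take an imitating prime `q`; then
`f(x) ≥ f_q(x) − 2/N ≥ −2/N`; let `N → ∞` (`le_of_tendsto`).  `|λ(n)| ≤ 1` and `|(n/q)| ≤ 1` in `ℝ`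
are discharged inside the proof (`ArithmeticFunction.liouville_apply`, `jacobiSym.trichotomy`).

Shape (tree convention, cf. `Cruxes/AhfHighReal/Lines/birth.lean`): statements as named props
`Sig.stub_*` (same short names as the registered stubs, so the skeleton audit admits them as
hypotheses); registered stubs `stub_*` spell the signatures out verbatim (`sorry` lives ONLY there);
`CharacterImitation_of` is sorry-free; `CharacterImitation_proof : CharacterImitation :=
CharacterImitation_of stub_imitatingPrimes stub_sineTail` concludes the crux BY NAME.

Disproof used: none relevant (no `Disproof.lean` / Negative lemma exists for this crux —
`ledger crux ls stmt-RiemannHypothesis-16982`: no workfiles; the crux is a theorem in print).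
-/

namespace Summit.RiemannHypothesis.RiemannHypothesis.Cruxes.CharacterImitation.Birth

open Filter Topology
open Summit.RiemannHypothesis.RiemannHypothesis.Theses.CharacterSums (CharacterImitation ImitatingPrimes)

/-! ## The two stub statements as named propositions `Sig.stub_*` -/

namespace Sig

/-- **Stub 1 (ARITHMETIC INPUT — imitating primes; = support item `ImitatingPrimes`).** For every
`N` there is a prime `q ≡ 3 (mod 8)` with `q > N` and `(n/q) = λ(n)` for all `1 ≤ n ≤ N`
(CRT + quadratic reciprocity + Dirichlet's theorem on primes in progressions; complete
multiplicativity reduces to primes `p ≤ N`, and `p = 2` is automatic from `q ≡ 3 (mod 8)`).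
Instances: `q = 43` imitates `λ` on `[1, 10]`, `q = 163` on `[1, 40]` (Conrey p. 4). Size: M. -/
def stub_imitatingPrimes : Prop :=
  ∀ N : ℕ, ∃ q : ℕ, q.Prime ∧ q % 8 = 3 ∧ N < q ∧
    ∀ n : ℕ, 1 ≤ n → n ≤ N → jacobiSym (n : ℤ) q = ArithmeticFunction.liouville n

/-- **Stub 2 (ANALYTIC TAIL TRANSFER).** If `a b : ℕ → ℝ` are bounded by `1` in absolute value and
agree on `1 ≤ n ≤ N` (`N ≥ 1`), then for every real `x`
`|∑' n, aₙ sin(2πnx)/n² − ∑' n, bₙ sin(2πnx)/n²| ≤ 2/N`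
(summability by comparison with `∑ 1/n²`; the `n = 0` terms are `0`; tail
`∑_{n>N} |aₙ − bₙ|/n² ≤ 2 ∑_{n>N} 1/(n(n−1)) = 2/N`). Size: M. -/
def stub_sineTail : Prop :=
  ∀ (a b : ℕ → ℝ) (N : ℕ), 1 ≤ N → (∀ n : ℕ, |a n| ≤ 1) → (∀ n : ℕ, |b n| ≤ 1) →
    (∀ n : ℕ, 1 ≤ n → n ≤ N → a n = b n) → ∀ x : ℝ,
      |(∑' n : ℕ, a n * Real.sin (2 * Real.pi * n * x) / (n : ℝ) ^ 2) -
          (∑' n : ℕ, b n * Real.sin (2 * Real.pi * n * x) / (n : ℝ) ^ 2)| ≤ 2 / (N : ℝ)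

end Sig

/-! ## The registered stubs (full signatures spelled out verbatim; `sorry` lives only here) -/

/-- Registered stub `stub_imitatingPrimes` (= `Sig.stub_imitatingPrimes` = the route's support item
`ImitatingPrimes`, spelled out so that a `Theorems/` proof can restate it verbatim). -/
theorem stub_imitatingPrimes :
    ∀ N : ℕ, ∃ q : ℕ, q.Prime ∧ q % 8 = 3 ∧ N < q ∧
      ∀ n : ℕ, 1 ≤ n → n ≤ N → jacobiSym (n : ℤ) q = ArithmeticFunction.liouville n := by
  sorry

/-- Registered stub `stub_sineTail` (= `Sig.stub_sineTail`, spelled out). -/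
theorem stub_sineTail :
    ∀ (a b : ℕ → ℝ) (N : ℕ), 1 ≤ N → (∀ n : ℕ, |a n| ≤ 1) → (∀ n : ℕ, |b n| ≤ 1) →
      (∀ n : ℕ, 1 ≤ n → n ≤ N → a n = b n) → ∀ x : ℝ,
        |(∑' n : ℕ, a n * Real.sin (2 * Real.pi * n * x) / (n : ℝ) ^ 2) -
            (∑' n : ℕ, b n * Real.sin (2 * Real.pi * n * x) / (n : ℝ) ^ 2)| ≤ 2 / (N : ℝ) := by
  sorry

/-! ## Composition (sorry-free) and the skeleton theorem -/

/-- `|λ(n)| ≤ 1` as a real number (`λ(0) = 0`, otherwise `λ(n) = (−1)^{Ω(n)}`). -/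
theorem abs_liouville_cast_le_one (n : ℕ) :
    |((ArithmeticFunction.liouville n : ℤ) : ℝ)| ≤ 1 := by
  rcases eq_or_ne n 0 with rfl | hn
  · simp
  · rw [ArithmeticFunction.liouville_apply hn]
    simp [abs_pow]

/-- `|(n/q)| ≤ 1` as a real number (the Jacobi symbol takes the values `0, 1, −1`). -/
theorem abs_jacobiSym_cast_le_one (n : ℤ) (q : ℕ) : |((jacobiSym n q : ℤ) : ℝ)| ≤ 1 := by
  rcases jacobiSym.trichotomy n q with h | h | h <;> simp [h]

/-- **Composition (Conrey 2024, proof of Theorem 3, first half).** The two stub statements imply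
the crux `Summit.RiemannHypothesis.RiemannHypothesis.Theses.CharacterSums.CharacterImitation`
BY NAME: for `x ∈ [0, 1/4]` and every `N ≥ 1`, an imitating prime `q ≡ 3 (mod 8)` (stub 1) has
`f_q(x) ≥ 0` by hypothesis and `|f(x) − f_q(x)| ≤ 2/N` (stub 2), so `f(x) ≥ −2/N`; let `N → ∞`. -/
theorem CharacterImitation_of (hI : Sig.stub_imitatingPrimes) (hT : Sig.stub_sineTail) :
    CharacterImitation := by
  intro hpos x hx0 hx1
  -- the squeeze: `f(x) ≥ -2/N` for every `N ≥ 1`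
  have key : ∀ N : ℕ, 1 ≤ N →
      -(2 / (N : ℝ)) ≤ ∑' n : ℕ, (ArithmeticFunction.liouville n : ℝ) *
        Real.sin (2 * Real.pi * n * x) / (n : ℝ) ^ 2 := by
    intro N hN
    obtain ⟨q, hq, hq8, -, himit⟩ := hI N
    have hfq := hpos q hq hq8 x hx0 hx1
    have htail := hT (fun n => (ArithmeticFunction.liouville n : ℝ))
      (fun n => (jacobiSym (n : ℤ) q : ℝ)) N hN (fun n => abs_liouville_cast_le_one n)
      (fun n => abs_jacobiSym_cast_le_one n q)
      (fun n h1 h2 => by exact_mod_cast (himit n h1 h2).symm) x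
    beta_reduce at htail
    rw [abs_le] at htail
    linarith [htail.1, htail.2, hfq]
  -- let `N → ∞`
  have lim : Tendsto (fun N : ℕ => -(2 / (N : ℝ))) atTop (𝓝 0) := by
    simpa using (tendsto_const_div_atTop_nhds_zero_nat (2 : ℝ)).neg
  refine le_of_tendsto lim ?_
  exact Filter.eventually_atTop.2 ⟨1, fun N hN => key N hN⟩

/-- **The skeleton**: the crux BY NAME from the two registered stubs (depends on `sorryAx` only
through `stub_*`). -/
theorem CharacterImitation_proof : CharacterImitation :=
  CharacterImitation_of stub_imitatingPrimes stub_sineTail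

/-! ## Calibration (sorry-free) -/

/-- Stub 1 is literally the route's support item `ImitatingPrimes` (stmt-RiemannHypothesis-16984),
and the registered stubs are literally the `Sig` propositions. -/
example : (Sig.stub_imitatingPrimes ↔ ImitatingPrimes) ∧
    (Sig.stub_sineTail ↔ (∀ (a b : ℕ → ℝ) (N : ℕ), 1 ≤ N → (∀ n : ℕ, |a n| ≤ 1) →
      (∀ n : ℕ, |b n| ≤ 1) → (∀ n : ℕ, 1 ≤ n → n ≤ N → a n = b n) → ∀ x : ℝ,
        |(∑' n : ℕ, a n * Real.sin (2 * Real.pi * n * x) / (n : ℝ) ^ 2) -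
            (∑' n : ℕ, b n * Real.sin (2 * Real.pi * n * x) / (n : ℝ) ^ 2)| ≤ 2 / (N : ℝ))) :=
  ⟨Iff.rfl, Iff.rfl⟩

/-- Calibration of stub 2 in the degenerate case `a = b` (the bound is then `0 ≤ 2/N`): the
statement is not vacuous and the constants compute. -/
example (a : ℕ → ℝ) (N : ℕ) (x : ℝ) :
    |(∑' n : ℕ, a n * Real.sin (2 * Real.pi * n * x) / (n : ℝ) ^ 2) -
        (∑' n : ℕ, a n * Real.sin (2 * Real.pi * n * x) / (n : ℝ) ^ 2)| ≤ 2 / (N : ℝ) := by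
  rw [sub_self, abs_zero]
  positivity

end Summit.RiemannHypothesis.RiemannHypothesis.Cruxes.CharacterImitation.Birth
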